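/-
Copyright (c) 2026 the pub-hodgecm-mathlib formalisation cell (harness21).  Prover seat hodgecm-mathlib-K2Liu-p09 (g5): Track B «K2-LIT»,
hLiu418 = stmt-HodgeConjecture-24832; LEAD F0P6-plan RULINGS M-156m∕o, M-157a (4)∕c∕m «A7 = GK COCYCLE ROAD», file B7-L.
-/
import Summits.HodgeConjecture.HodgeConjecture.Theorems.K2LiuSiegelCocycleLetters              -- ★ B4d-1b (+ B4d-1, B1b-2c, B1b-2a, B4c-*)
import Summits.HodgeConjecture.HodgeConjecture.Theorems.K2LiuDoubledUTwoTwoUnipotentHaar         -- ★ B1b-2b `exists_homeomorph_coordTwo` (the shape of `e`)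
import HarnessLib

/-!
# Crux `HLiu418`, road `K2_Liu`, organ A7-reg (GK cocycle road), file B7-L:
# THE LETTERS OF THE RANK-ONE STEPS — `u(0) = 1`, `ū(0) = 1` and continuity, through the coordinates homeomorphism of `N_Δ(F_v)`

Cell `hodgecm-mathlib`, crux item hLiu418 = `stmt-HodgeConjecture-24832`; squad K2 ∕ K2Liu; prover K2Liu-p09 (g5).  THEOREMS ONLY (no `def`, no instance,
no notation, no named-fact hypothesis, no `sorry`); lane `--supports stmt-HodgeConjecture-24832` (count-neutral helper).  ONE FRAME (RULING M-156o (c)):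
`φ := frameConj Q ∘ toLocalFour` (★ B1b-1, K2Liu-p03 (g6)).
THE POINT.  ★ `K2LiuRankOneOperators.exists_level₂ (u ū) (hu : Continuous u) (hu0 : u 0 = 1) (hū) (hū0) (K′ open) (y)` produces the level `m` of every rank-one
stage; its four hypotheses are discharged here for the letters of the cocycle, all through K2Liu-p03 (g6)'s coordinates homeomorphism
`e : F_v × (E ⊗ F_v) × F_v ≃ₜ N_Δ(F_v)`, `e(b₁, z, b₂) = φ(n(ι_v(b₁)δ, z, ι_v(b₂)δ))` (★ B1b-2b `exists_homeomorph_coordTwo`):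
* §1 long-root steps: `u(y) = φ(u_{2e₂}(ι_v(y)δ)) = e(y,0,0)`, `ū(t) = φ(w₂) φ(u_{2e₂}(ι_v(t)δ⁻¹)) φ(w₂) = φ(w₂) u(t d⁻¹) φ(w₂)` (`δ⁻¹ = d⁻¹δ`).
* §2 short-root steps at `w ∣ v`: `u_w(ζ) = φ(u₋(1_w ζ))` with `φ(u₋(z)) = φ(w₂) e(0,z,0) φ(w₂)` (`w₂ u₋(z) w₂ = u₊(z)`, ★ `weylTwo_mul_uMinus`),
  `ū_w(ζ) = φ(P_w) u_w(ζ) φ(P_w)`, `P_w² = 1`.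
HONEST LABEL.  `HC_CM` is proved only modulo the 7 printed citations (2 remaining named inputs: hLiu418 = `stmt-HodgeConjecture-24832`,
h413 = `stmt-HodgeConjecture-24833`) until rung 0 closes.

## References
* [HarrisKudlaSweet1996] M. Harris, S. Kudla, W. J. Sweet, J. AMS 9 (1996), §1 (1.11)–(1.12).
* [BushnellHenniart2006] C. Bushnell, G. Henniart, *The local Langlands conjecture for GL(2)* (2006), §1.1 (smooth vectors, levels).
* [CasselsFrohlichANT1967] J. W. S. Cassels, A. Fröhlich (eds.), *Algebraic Number Theory* (1967), Ch. II §10.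
-/

set_option autoImplicit false
set_option linter.dupNamespace false -- the mandated namespace repeats `HodgeConjecture.HodgeConjecture`

noncomputable section

open scoped Classical
open NumberField IsDedekindDomain Matrix
open Literature.NumberTheory.Automorphic Literature.NumberTheory.Automorphic.UnitaryGroup
open Literature.NumberTheory.GelbartRogawski1991.AdaptedBlocks
open Literature.NumberTheory.GelbartRogawski1991.UnitaryDualPair.LocalSplitting
open Literature.NumberTheory.K2Lit.LocalSiegelDoubled
open Summit.HodgeConjecture.HodgeConjecture.Cruxes.HLiu418.K2LiuLocalSiegelIwasawaFrame
open Summit.HodgeConjecture.HodgeConjecture.Cruxes.HLiu418.K2LiuLocalSiegelIwasawa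
open Summit.HodgeConjecture.HodgeConjecture.Cruxes.HLiu418.K2LiuDoubledUTwoTwoBorelFrame
open Summit.HodgeConjecture.HodgeConjecture.Cruxes.HLiu418.K2LiuDoubledUTwoTwoWeylCocycle
open Summit.HodgeConjecture.HodgeConjecture.Cruxes.HLiu418.K2LiuDoubledUTwoTwoLevi
open Summit.HodgeConjecture.HodgeConjecture.Cruxes.HLiu418.K2LiuDoubledUTwoTwoFrameTransport
open Summit.HodgeConjecture.HodgeConjecture.Cruxes.HLiu418.K2LiuUnipDeltaRankOneCoordinates
open Summit.HodgeConjecture.HodgeConjecture.Cruxes.HLiu418.K2LiuDoubledUTwoTwoRankOneRelationsLevi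
open Summit.HodgeConjecture.HodgeConjecture.Cruxes.HLiu418.K2LiuSiegelCocycleLetters

namespace Summit.HodgeConjecture.HodgeConjecture.Cruxes.HLiu418.K2LiuSiegelCocycleStageLetters

variable (F : Type) [Field F] [NumberField F] (E : Type) [Field E] [NumberField E] [Algebra F E]
  [Algebra.IsQuadraticExtension F E] (c : E ≃ₐ[F] E)
  {δ : E} (hcδ : c δ = -δ) (hδ : δ ≠ 0) {d : F} (hd : δ * δ = algebraMap F E d) (v : HeightOneSpectrum (𝓞 F))
  {T₂ : Matrix (Fin 2) (Fin 2) F} {J₂D : Matrix (Fin (2 + 2)) (Fin (2 + 2)) E} (hJ₂D : J₂D = (gramD F 2 T₂).map (algebraMap F E))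
  (Q : GL (Fin (2 + 2)) F)
  (hQ : (Q : Matrix (Fin (2 + 2)) (Fin (2 + 2)) F)ᵀ * gramD F 2 T₂ * (Q : Matrix (Fin (2 + 2)) (Fin (2 + 2)) F) = (StdForm.antidiagonal (2 + 2)).over F)

/-! ## §1 The letters of the long-root steps: `u(0) = 1`, `ū(0) = 1`, continuity -/

section LettersLong

omit [Algebra.IsQuadraticExtension F E] in
include hcδ in
/-- `u(0) = 1`. [cite: HarrisKudlaSweet1996, §1 (1.11)] -/
theorem frameConj_uLongTwo_coord_zero :
    FrameTransport.frameConj F E c v (2 + 2) hJ₂D (antidiagonal_over_eq_map F E 2) Q hQ (toLocalFour F E c v (uLongTwo (UnitaryGroup.LocalRing E v) (UnitaryGroup.conjLocal E c v)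
      (UnitaryGroup.toLocalRing E v 0 * algebraMap E (UnitaryGroup.LocalRing E v) δ) (conjLocal_coord F E c hcδ v 0))) = 1 := by
  rw [uLongTwo_congr F E c v _ (by rw [map_zero, neg_zero]) (by rw [map_zero, zero_mul]), uLongTwo_zero, map_one, map_one]

include hcδ hδ in
/-- **`u` is continuous**: `φ(u_{2e₂}(ι_v(y)δ)) = e(y, 0, 0)` for the coordinates homeomorphism `e` of ★ B1b-2b. [cite: HarrisKudlaSweet1996, §1 (1.11)] -/
theorem continuous_frameConj_uLongTwo_coord (e : (v.adicCompletion F × UnitaryGroup.LocalRing E v × v.adicCompletion F) ≃ₜ unipDeltaLocal F E c v 2 (JD := J₂D))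
    (he : ∀ b₁ z b₂, ((e (b₁, z, b₂) : unipDeltaLocal F E c v 2 (JD := J₂D)) : UnitaryGroup.localPi E c (2 + 2) J₂D v) =
      FrameTransport.frameConj F E c v (2 + 2) hJ₂D (antidiagonal_over_eq_map F E 2) Q hQ
          (toLocalFour F E c v (nSiegel (UnitaryGroup.LocalRing E v) (UnitaryGroup.conjLocal E c v) (UnitaryGroup.conjLocal_conjLocal c v hcδ hδ)
            (UnitaryGroup.toLocalRing E v b₁ * algebraMap E (UnitaryGroup.LocalRing E v) δ) z
            (UnitaryGroup.toLocalRing E v b₂ * algebraMap E (UnitaryGroup.LocalRing E v) δ)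
            (conjLocal_coord F E c hcδ v b₁) (conjLocal_coord F E c hcδ v b₂)))) :
    Continuous fun y : v.adicCompletion F => FrameTransport.frameConj F E c v (2 + 2) hJ₂D (antidiagonal_over_eq_map F E 2) Q hQ (toLocalFour F E c v
      (uLongTwo (UnitaryGroup.LocalRing E v) (UnitaryGroup.conjLocal E c v) (UnitaryGroup.toLocalRing E v y * algebraMap E (UnitaryGroup.LocalRing E v) δ) (conjLocal_coord F E c hcδ v y))) := by
  have h : ∀ y : v.adicCompletion F, FrameTransport.frameConj F E c v (2 + 2) hJ₂D (antidiagonal_over_eq_map F E 2) Q hQ (toLocalFour F E c v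
      (uLongTwo (UnitaryGroup.LocalRing E v) (UnitaryGroup.conjLocal E c v) (UnitaryGroup.toLocalRing E v y * algebraMap E (UnitaryGroup.LocalRing E v) δ) (conjLocal_coord F E c hcδ v y))) =
      ((e (y, 0, 0) : unipDeltaLocal F E c v 2 (JD := J₂D)) : UnitaryGroup.localPi E c (2 + 2) J₂D v) := by
    intro y
    have h1 : uLongOne (UnitaryGroup.LocalRing E v) (UnitaryGroup.conjLocal E c v) (UnitaryGroup.toLocalRing E v 0 * algebraMap E (UnitaryGroup.LocalRing E v) δ)
        (conjLocal_coord F E c hcδ v 0) = 1 := by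
      have e1 : UnitaryGroup.toLocalRing E v 0 * algebraMap E (UnitaryGroup.LocalRing E v) δ = 0 := by rw [map_zero, zero_mul]
      rw [← uLongOne_zero (UnitaryGroup.LocalRing E v) (UnitaryGroup.conjLocal E c v)]
      exact (fun {y y' : UnitaryGroup.LocalRing E v} (hy : UnitaryGroup.conjLocal E c v y = -y) (hy' : UnitaryGroup.conjLocal E c v y' = -y') (hh : y = y') =>
        show uLongOne (UnitaryGroup.LocalRing E v) (UnitaryGroup.conjLocal E c v) y hy = uLongOne (UnitaryGroup.LocalRing E v) (UnitaryGroup.conjLocal E c v) y' hy' by subst hh; rfl) _ _ e1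
    rw [he, nSiegel, uPlus_zero, mul_one, h1, mul_one]
  simp_rw [h]
  exact continuous_subtype_val.comp (e.continuous.comp (Continuous.prodMk continuous_id continuous_const))

omit [Algebra.IsQuadraticExtension F E] in
include hd hδ in
/-- `δ⁻¹ = d⁻¹ δ` in `E ⊗ F_v`: `ι_v(t) · (δ ⊗ 1)⁻¹ = ι_v(t d⁻¹) · (δ ⊗ 1)`. [cite: CasselsFrohlichANT1967, Ch. II §10] -/
theorem toLocalRing_mul_algebraMap_inv (t : v.adicCompletion F) :
    UnitaryGroup.toLocalRing E v t * algebraMap E (UnitaryGroup.LocalRing E v) δ⁻¹ =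
      UnitaryGroup.toLocalRing E v (t * ((d⁻¹ : F) : v.adicCompletion F)) * algebraMap E (UnitaryGroup.LocalRing E v) δ := by
  have hd0 : algebraMap F E d ≠ 0 := by rw [← hd]; exact mul_ne_zero hδ hδ
  have hinv : δ⁻¹ = algebraMap F E d⁻¹ * δ := by
    rw [map_inv₀, eq_inv_mul_iff_mul_eq₀ hd0, ← hd, mul_inv_cancel_right₀ hδ]
  rw [map_mul, toLocalRing_coe, hinv, map_mul, mul_assoc]

omit [Algebra.IsQuadraticExtension F E] in
include hcδ hd hδ in
/-- **the `ū`-letter through `u`**: `φ(u_{2e₂}(ι_v(t)δ⁻¹)) = φ(u_{2e₂}(ι_v(t d⁻¹)δ))`. [cite: CasselsFrohlichANT1967, Ch. II §10] -/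
theorem frameConj_uLongTwo_coord_inv_eq (t : v.adicCompletion F) :
    FrameTransport.frameConj F E c v (2 + 2) hJ₂D (antidiagonal_over_eq_map F E 2) Q hQ (toLocalFour F E c v (uLongTwo (UnitaryGroup.LocalRing E v) (UnitaryGroup.conjLocal E c v)
        (UnitaryGroup.toLocalRing E v t * algebraMap E (UnitaryGroup.LocalRing E v) δ⁻¹) (conjLocal_coord_inv F E c hcδ v t))) =
      FrameTransport.frameConj F E c v (2 + 2) hJ₂D (antidiagonal_over_eq_map F E 2) Q hQ (toLocalFour F E c v (uLongTwo (UnitaryGroup.LocalRing E v) (UnitaryGroup.conjLocal E c v)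
        (UnitaryGroup.toLocalRing E v (t * ((d⁻¹ : F) : v.adicCompletion F)) * algebraMap E (UnitaryGroup.LocalRing E v) δ) (conjLocal_coord F E c hcδ v _))) := by
  rw [uLongTwo_congr F E c v _ _ (toLocalRing_mul_algebraMap_inv F E hδ hd v t)]

include hcδ hd hδ in
/-- **`ū` is continuous** (`ū(t) = φ(w₂) u(t d⁻¹) φ(w₂)`). [cite: HarrisKudlaSweet1996, §1 (1.11)] -/
theorem continuous_ubar (e : (v.adicCompletion F × UnitaryGroup.LocalRing E v × v.adicCompletion F) ≃ₜ unipDeltaLocal F E c v 2 (JD := J₂D))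
    (he : ∀ b₁ z b₂, ((e (b₁, z, b₂) : unipDeltaLocal F E c v 2 (JD := J₂D)) : UnitaryGroup.localPi E c (2 + 2) J₂D v) =
      FrameTransport.frameConj F E c v (2 + 2) hJ₂D (antidiagonal_over_eq_map F E 2) Q hQ
          (toLocalFour F E c v (nSiegel (UnitaryGroup.LocalRing E v) (UnitaryGroup.conjLocal E c v) (UnitaryGroup.conjLocal_conjLocal c v hcδ hδ)
            (UnitaryGroup.toLocalRing E v b₁ * algebraMap E (UnitaryGroup.LocalRing E v) δ) z
            (UnitaryGroup.toLocalRing E v b₂ * algebraMap E (UnitaryGroup.LocalRing E v) δ)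
            (conjLocal_coord F E c hcδ v b₁) (conjLocal_coord F E c hcδ v b₂)))) :
    Continuous fun t : v.adicCompletion F =>
      FrameTransport.frameConj F E c v (2 + 2) hJ₂D (antidiagonal_over_eq_map F E 2) Q hQ (toLocalFour F E c v (weylTwo (UnitaryGroup.LocalRing E v) (UnitaryGroup.conjLocal E c v))) *
        FrameTransport.frameConj F E c v (2 + 2) hJ₂D (antidiagonal_over_eq_map F E 2) Q hQ (toLocalFour F E c v (uLongTwo (UnitaryGroup.LocalRing E v) (UnitaryGroup.conjLocal E c v)
          (UnitaryGroup.toLocalRing E v t * algebraMap E (UnitaryGroup.LocalRing E v) δ⁻¹) (conjLocal_coord_inv F E c hcδ v t))) *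
        FrameTransport.frameConj F E c v (2 + 2) hJ₂D (antidiagonal_over_eq_map F E 2) Q hQ (toLocalFour F E c v (weylTwo (UnitaryGroup.LocalRing E v) (UnitaryGroup.conjLocal E c v))) := by
  simp_rw [frameConj_uLongTwo_coord_inv_eq F E c hcδ hδ hd v hJ₂D Q hQ]
  exact (continuous_const.mul ((continuous_frameConj_uLongTwo_coord F E c hcδ hδ v hJ₂D Q hQ e he).comp (continuous_id.mul continuous_const))).mul
    continuous_const

omit [Algebra.IsQuadraticExtension F E] in
include hcδ hd hδ in
/-- `ū(0) = 1` (`w₂² = 1`, ★ `weylTwo_mul_weylTwo`). [cite: HarrisKudlaSweet1996, §1 (1.12)] -/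
theorem ubar_zero :
    FrameTransport.frameConj F E c v (2 + 2) hJ₂D (antidiagonal_over_eq_map F E 2) Q hQ (toLocalFour F E c v (weylTwo (UnitaryGroup.LocalRing E v) (UnitaryGroup.conjLocal E c v))) *
        FrameTransport.frameConj F E c v (2 + 2) hJ₂D (antidiagonal_over_eq_map F E 2) Q hQ (toLocalFour F E c v (uLongTwo (UnitaryGroup.LocalRing E v) (UnitaryGroup.conjLocal E c v)
          (UnitaryGroup.toLocalRing E v 0 * algebraMap E (UnitaryGroup.LocalRing E v) δ⁻¹) (conjLocal_coord_inv F E c hcδ v 0))) *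
        FrameTransport.frameConj F E c v (2 + 2) hJ₂D (antidiagonal_over_eq_map F E 2) Q hQ (toLocalFour F E c v (weylTwo (UnitaryGroup.LocalRing E v) (UnitaryGroup.conjLocal E c v))) = 1 := by
  rw [frameConj_uLongTwo_coord_inv_eq F E c hcδ hδ hd v hJ₂D Q hQ, zero_mul, frameConj_uLongTwo_coord_zero F E c hcδ v hJ₂D Q hQ, mul_one, ← map_mul, ← map_mul,
    weylTwo_mul_weylTwo, map_one, map_one]

end LettersLong

/-! ## §2 The letters of the short-root steps at `w ∣ v` -/

section LettersShort

variable (w : PlacesOver E v)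

include hcδ hδ in
/-- **`φ(u₋(z)) = φ(w₂) φ(u₊(z)) φ(w₂)`** (★ `weylTwo_mul_uMinus`, `w₂² = 1`). [cite: HarrisKudlaSweet1996, §1 (1.12)] -/
theorem frameConj_uMinus_eq (z : UnitaryGroup.LocalRing E v) :
    FrameTransport.frameConj F E c v (2 + 2) hJ₂D (antidiagonal_over_eq_map F E 2) Q hQ (toLocalFour F E c v
        (uMinus (UnitaryGroup.LocalRing E v) (UnitaryGroup.conjLocal E c v) (UnitaryGroup.conjLocal_conjLocal c v hcδ hδ) z)) =
      FrameTransport.frameConj F E c v (2 + 2) hJ₂D (antidiagonal_over_eq_map F E 2) Q hQ (toLocalFour F E c v (weylTwo (UnitaryGroup.LocalRing E v) (UnitaryGroup.conjLocal E c v))) *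
        FrameTransport.frameConj F E c v (2 + 2) hJ₂D (antidiagonal_over_eq_map F E 2) Q hQ (toLocalFour F E c v
          (uPlus (UnitaryGroup.LocalRing E v) (UnitaryGroup.conjLocal E c v) (UnitaryGroup.conjLocal_conjLocal c v hcδ hδ) z)) *
        FrameTransport.frameConj F E c v (2 + 2) hJ₂D (antidiagonal_over_eq_map F E 2) Q hQ (toLocalFour F E c v (weylTwo (UnitaryGroup.LocalRing E v) (UnitaryGroup.conjLocal E c v))) := by
  have hgrp : uMinus (UnitaryGroup.LocalRing E v) (UnitaryGroup.conjLocal E c v) (UnitaryGroup.conjLocal_conjLocal c v hcδ hδ) z =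
      weylTwo (UnitaryGroup.LocalRing E v) (UnitaryGroup.conjLocal E c v) *
        uPlus (UnitaryGroup.LocalRing E v) (UnitaryGroup.conjLocal E c v) (UnitaryGroup.conjLocal_conjLocal c v hcδ hδ) z *
        weylTwo (UnitaryGroup.LocalRing E v) (UnitaryGroup.conjLocal E c v) := by
    rw [mul_assoc, ← weylTwo_mul_uMinus, ← mul_assoc, weylTwo_mul_weylTwo, one_mul]
  rw [hgrp, map_mul, map_mul, map_mul, map_mul]

include hcδ hδ in
/-- **`z ↦ φ(u₋(z))` is continuous**: `φ(u₊(z)) = e(0, z, 0)` for the coordinates homeomorphism `e` of ★ B1b-2b. [cite: HarrisKudlaSweet1996, §1 (1.11)] -/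
theorem continuous_frameConj_uMinus (e : (v.adicCompletion F × UnitaryGroup.LocalRing E v × v.adicCompletion F) ≃ₜ unipDeltaLocal F E c v 2 (JD := J₂D))
    (he : ∀ b₁ z b₂, ((e (b₁, z, b₂) : unipDeltaLocal F E c v 2 (JD := J₂D)) : UnitaryGroup.localPi E c (2 + 2) J₂D v) =
      FrameTransport.frameConj F E c v (2 + 2) hJ₂D (antidiagonal_over_eq_map F E 2) Q hQ
          (toLocalFour F E c v (nSiegel (UnitaryGroup.LocalRing E v) (UnitaryGroup.conjLocal E c v) (UnitaryGroup.conjLocal_conjLocal c v hcδ hδ)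
            (UnitaryGroup.toLocalRing E v b₁ * algebraMap E (UnitaryGroup.LocalRing E v) δ) z
            (UnitaryGroup.toLocalRing E v b₂ * algebraMap E (UnitaryGroup.LocalRing E v) δ)
            (conjLocal_coord F E c hcδ v b₁) (conjLocal_coord F E c hcδ v b₂)))) :
    Continuous fun z : UnitaryGroup.LocalRing E v => FrameTransport.frameConj F E c v (2 + 2) hJ₂D (antidiagonal_over_eq_map F E 2) Q hQ (toLocalFour F E c v
      (uMinus (UnitaryGroup.LocalRing E v) (UnitaryGroup.conjLocal E c v) (UnitaryGroup.conjLocal_conjLocal c v hcδ hδ) z)) := by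
  have h : ∀ z : UnitaryGroup.LocalRing E v, FrameTransport.frameConj F E c v (2 + 2) hJ₂D (antidiagonal_over_eq_map F E 2) Q hQ (toLocalFour F E c v
      (uPlus (UnitaryGroup.LocalRing E v) (UnitaryGroup.conjLocal E c v) (UnitaryGroup.conjLocal_conjLocal c v hcδ hδ) z)) =
      ((e (0, z, 0) : unipDeltaLocal F E c v 2 (JD := J₂D)) : UnitaryGroup.localPi E c (2 + 2) J₂D v) := by
    intro z
    rw [he, nSiegel, uLongTwo_congr F E c v _ (by rw [map_zero, neg_zero]) (by rw [map_zero, zero_mul] :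
      UnitaryGroup.toLocalRing E v 0 * algebraMap E (UnitaryGroup.LocalRing E v) δ = 0), uLongTwo_zero, one_mul]
    have h1 : uLongOne (UnitaryGroup.LocalRing E v) (UnitaryGroup.conjLocal E c v) (UnitaryGroup.toLocalRing E v 0 * algebraMap E (UnitaryGroup.LocalRing E v) δ)
        (conjLocal_coord F E c hcδ v 0) = 1 := by
      rw [← uLongOne_zero (UnitaryGroup.LocalRing E v) (UnitaryGroup.conjLocal E c v)]
      exact (fun {y y' : UnitaryGroup.LocalRing E v} (hy : UnitaryGroup.conjLocal E c v y = -y) (hy' : UnitaryGroup.conjLocal E c v y' = -y') (hh : y = y') =>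
        show uLongOne (UnitaryGroup.LocalRing E v) (UnitaryGroup.conjLocal E c v) y hy = uLongOne (UnitaryGroup.LocalRing E v) (UnitaryGroup.conjLocal E c v) y' hy' by subst hh; rfl)
        _ _ (by rw [map_zero, zero_mul])
    rw [h1, mul_one]
  simp_rw [frameConj_uMinus_eq F E c hcδ hδ v hJ₂D Q hQ, h]
  exact (continuous_const.mul (continuous_subtype_val.comp (e.continuous.comp
    ((continuous_const.prodMk (continuous_id.prodMk continuous_const)))))).mul continuous_const

include hcδ hδ in
/-- **`u_w(ζ) = φ(u₋(1_w ζ))` is continuous** and `u_w(0) = 1`. [cite: HarrisKudlaSweet1996, §1 (1.11)] [cite: BushnellHenniart2006, §1.1] -/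
theorem continuous_frameConj_uMinus_single (e : (v.adicCompletion F × UnitaryGroup.LocalRing E v × v.adicCompletion F) ≃ₜ unipDeltaLocal F E c v 2 (JD := J₂D))
    (he : ∀ b₁ z b₂, ((e (b₁, z, b₂) : unipDeltaLocal F E c v 2 (JD := J₂D)) : UnitaryGroup.localPi E c (2 + 2) J₂D v) =
      FrameTransport.frameConj F E c v (2 + 2) hJ₂D (antidiagonal_over_eq_map F E 2) Q hQ
          (toLocalFour F E c v (nSiegel (UnitaryGroup.LocalRing E v) (UnitaryGroup.conjLocal E c v) (UnitaryGroup.conjLocal_conjLocal c v hcδ hδ)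
            (UnitaryGroup.toLocalRing E v b₁ * algebraMap E (UnitaryGroup.LocalRing E v) δ) z
            (UnitaryGroup.toLocalRing E v b₂ * algebraMap E (UnitaryGroup.LocalRing E v) δ)
            (conjLocal_coord F E c hcδ v b₁) (conjLocal_coord F E c hcδ v b₂)))) :
    (Continuous fun ζ : w.1.adicCompletion E => FrameTransport.frameConj F E c v (2 + 2) hJ₂D (antidiagonal_over_eq_map F E 2) Q hQ (toLocalFour F E c v
      (uMinus (UnitaryGroup.LocalRing E v) (UnitaryGroup.conjLocal E c v) (UnitaryGroup.conjLocal_conjLocal c v hcδ hδ) (Pi.single w ζ)))) ∧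
    FrameTransport.frameConj F E c v (2 + 2) hJ₂D (antidiagonal_over_eq_map F E 2) Q hQ (toLocalFour F E c v
      (uMinus (UnitaryGroup.LocalRing E v) (UnitaryGroup.conjLocal E c v) (UnitaryGroup.conjLocal_conjLocal c v hcδ hδ) (Pi.single w (0 : w.1.adicCompletion E)))) = 1 :=
  ⟨(continuous_frameConj_uMinus F E c hcδ hδ v hJ₂D Q hQ e he).comp
      (continuous_single (A := fun w' : PlacesOver E v => w'.1.adicCompletion E) w),
    by rw [Pi.single_zero, uMinus_zero, map_one, map_one]⟩

omit [NumberField F] [Algebra.IsQuadraticExtension F E] in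
/-- **`P_w² = 1`**: the matrix `(1−ε ε; ε 1−ε)` of an idempotent `ε` squares to `1`. [cite: HarrisKudlaSweet1996, §6 (6.16)] -/
theorem partialWeylGL_mul_self {ε : UnitaryGroup.LocalRing E v} (hε : ε * ε = ε) (A : GL (Fin 2) (UnitaryGroup.LocalRing E v))
    (hA : A.val = !![1 - ε, ε; ε, 1 - ε]) : A * A = 1 := by
  refine Units.ext ?_
  have hM : (!![1 - ε, ε; ε, 1 - ε] : Matrix (Fin 2) (Fin 2) (UnitaryGroup.LocalRing E v)) = ε • !![0, 1; 1, 0] + (1 - ε) • 1 :=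
    Matrix.ext fun i j => by fin_cases i <;> fin_cases j <;> simp
  have hW : (!![0, 1; 1, 0] : Matrix (Fin 2) (Fin 2) (UnitaryGroup.LocalRing E v)) * !![0, 1; 1, 0] = 1 := by
    rw [Matrix.mul_fin_two, Matrix.one_fin_two]; simp
  rw [Units.val_mul, hA, Units.val_one, hM, comb_mul_comb hε, hW, one_mul, ← add_smul, add_sub_cancel, one_smul]

include hcδ hδ in
/-- **`ū_w(ζ) = φ(P_w) u_w(ζ) φ(P_w)` is continuous** and `ū_w(0) = 1` (`P_w² = 1`). [cite: HarrisKudlaSweet1996, §6 (6.16)] [cite: BushnellHenniart2006, §1.1] -/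
theorem continuous_ubar_single (e : (v.adicCompletion F × UnitaryGroup.LocalRing E v × v.adicCompletion F) ≃ₜ unipDeltaLocal F E c v 2 (JD := J₂D))
    (he : ∀ b₁ z b₂, ((e (b₁, z, b₂) : unipDeltaLocal F E c v 2 (JD := J₂D)) : UnitaryGroup.localPi E c (2 + 2) J₂D v) =
      FrameTransport.frameConj F E c v (2 + 2) hJ₂D (antidiagonal_over_eq_map F E 2) Q hQ
          (toLocalFour F E c v (nSiegel (UnitaryGroup.LocalRing E v) (UnitaryGroup.conjLocal E c v) (UnitaryGroup.conjLocal_conjLocal c v hcδ hδ)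
            (UnitaryGroup.toLocalRing E v b₁ * algebraMap E (UnitaryGroup.LocalRing E v) δ) z
            (UnitaryGroup.toLocalRing E v b₂ * algebraMap E (UnitaryGroup.LocalRing E v) δ)
            (conjLocal_coord F E c hcδ v b₁) (conjLocal_coord F E c hcδ v b₂))))
    {ε : UnitaryGroup.LocalRing E v} (hε : ε * ε = ε) (A : GL (Fin 2) (UnitaryGroup.LocalRing E v)) (hA : A.val = !![1 - ε, ε; ε, 1 - ε]) :
    (Continuous fun ζ : w.1.adicCompletion E =>
      FrameTransport.frameConj F E c v (2 + 2) hJ₂D (antidiagonal_over_eq_map F E 2) Q hQ (toLocalFour F E c v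
          (leviElt (UnitaryGroup.LocalRing E v) (UnitaryGroup.conjLocal E c v) (UnitaryGroup.conjLocal_conjLocal c v hcδ hδ) A)) *
        FrameTransport.frameConj F E c v (2 + 2) hJ₂D (antidiagonal_over_eq_map F E 2) Q hQ (toLocalFour F E c v
          (uMinus (UnitaryGroup.LocalRing E v) (UnitaryGroup.conjLocal E c v) (UnitaryGroup.conjLocal_conjLocal c v hcδ hδ) (Pi.single w ζ))) *
        FrameTransport.frameConj F E c v (2 + 2) hJ₂D (antidiagonal_over_eq_map F E 2) Q hQ (toLocalFour F E c v
          (leviElt (UnitaryGroup.LocalRing E v) (UnitaryGroup.conjLocal E c v) (UnitaryGroup.conjLocal_conjLocal c v hcδ hδ) A))) ∧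
    FrameTransport.frameConj F E c v (2 + 2) hJ₂D (antidiagonal_over_eq_map F E 2) Q hQ (toLocalFour F E c v
          (leviElt (UnitaryGroup.LocalRing E v) (UnitaryGroup.conjLocal E c v) (UnitaryGroup.conjLocal_conjLocal c v hcδ hδ) A)) *
        FrameTransport.frameConj F E c v (2 + 2) hJ₂D (antidiagonal_over_eq_map F E 2) Q hQ (toLocalFour F E c v
          (uMinus (UnitaryGroup.LocalRing E v) (UnitaryGroup.conjLocal E c v) (UnitaryGroup.conjLocal_conjLocal c v hcδ hδ) (Pi.single w (0 : w.1.adicCompletion E)))) *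
        FrameTransport.frameConj F E c v (2 + 2) hJ₂D (antidiagonal_over_eq_map F E 2) Q hQ (toLocalFour F E c v
          (leviElt (UnitaryGroup.LocalRing E v) (UnitaryGroup.conjLocal E c v) (UnitaryGroup.conjLocal_conjLocal c v hcδ hδ) A)) = 1 := by
  obtain ⟨hc, h0⟩ := continuous_frameConj_uMinus_single F E c hcδ hδ v hJ₂D Q hQ w e he
  refine ⟨(continuous_const.mul hc).mul continuous_const, ?_⟩
  rw [h0, mul_one, ← map_mul, ← map_mul, leviElt_mul, partialWeylGL_mul_self F E v hε A hA, leviElt_one, map_one, map_one]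

end LettersShort

end Summit.HodgeConjecture.HodgeConjecture.Cruxes.HLiu418.K2LiuSiegelCocycleStageLetters

end
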